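import Mathlib
import HarnessLib
import Summits.NavierStokesRegularity.NavierStokesRegularity.Theorems.UnthreadedDoorNetFluxNF1aExtremalHeadEMFOfLevelLip

/-!
# Route `UnthreadedDoor`, crux `PoloidalLiouville` (stmt-NavierStokesRegularity-1222), WALL W1 — crux idea «null-time» (ns-idea-14 g5,
# `Cruxes/PoloidalLiouville/NullTimeSketch.lean`): stub AE-0 `ExtremalHeadEMFOfLevelLipIoo`, PROVED (by name)

`NF1a.extremalHeadEMF_of_levelLip_Ioo : <body of NullTime.ExtremalHeadEMFOfLevelLipIoo VERBATIM>`: hinge (a) of the netflux chain fed by the slice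
level-Lipschitz property — the landed K2 `NF1a.extremalHeadEMF_of_levelLip` (p680049), which is stated on windows `Ioo t₀ 0` — on an ARBITRARY open
time interval `Ioo α β`.  PROOF = time translation: every hypothesis of K2 is window-local, so K2 applied to `s ↦ v (s + β)`, `T (s + β)`, `P (s + β)`,
`V (s + β)` on `Ioo (α − β) 0` gives a head difference `I'`, and `I t r := I' (t − β) r` has properties (i)–(v) on `Ioo α β`.
In the sketch: `theorem stub_extremalHeadEMFOfLevelLipIoo : ExtremalHeadEMFOfLevelLipIoo := Theorems.PoloidalLiouville.NetFlux.NF1a.extremalHeadEMF_of_levelLip_Ioo`.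

HONEST LABEL: one S stub of the a.e.-time chain (crux idea «null-time», K3ᵃᵉ); `PoloidalLiouville` (1222), C⁻, W1 and the summit stay OPEN; NO
Navier–Stokes regularity statement is proved.  `--supports stmt-NavierStokesRegularity-1222 --as helper`.  [folklore]
-/

noncomputable section

-- the summit and its single sub-problem share the name (CONVENTIONS §1)
set_option linter.dupNamespace false

open Set Function Filter Topology InnerProductSpace MeasureTheory
open scoped RealInnerProductSpace NNReal

namespace Summit.NavierStokesRegularity.NavierStokesRegularity.Theorems.PoloidalLiouville.NetFlux.NF1a

open Literature.Analysis Literature.Analysis.FluidPDE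

/-- Time translation of joint smoothness: if `uncurry F` is `C^∞` on `Ioo α β ×ˢ A` then `uncurry (fun s => F (s + β))` is `C^∞` on
`Ioo (α − β) 0 ×ˢ A`. [folklore] -/
theorem contDiffOn_uncurry_timeShift {X : Type*} [NormedAddCommGroup X] [NormedSpace ℝ X] {F : ℝ → E3 → X} {α β : ℝ} {A : Set E3}
    (hF : ContDiffOn ℝ (⊤ : ℕ∞) (uncurry F) (Ioo α β ×ˢ A)) :
    ContDiffOn ℝ (⊤ : ℕ∞) (uncurry fun s => F (s + β)) (Ioo (α - β) 0 ×ˢ A) := by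
  have hmap : MapsTo (fun p : ℝ × E3 => (p.1 + β, p.2)) (Ioo (α - β) 0 ×ˢ A) (Ioo α β ×ˢ A) := by
    rintro ⟨s, x⟩ ⟨hs, hx⟩
    exact ⟨⟨by linarith [hs.1], by linarith [hs.2]⟩, hx⟩
  have hφ : ContDiff ℝ (⊤ : ℕ∞) (fun p : ℝ × E3 => (p.1 + β, p.2)) :=
    (contDiff_fst.add contDiff_const).prodMk contDiff_snd
  have := hF.comp hφ.contDiffOn hmap
  exact this

/-- **AE-0 `ExtremalHeadEMFOfLevelLipIoo`, proved**: the landed hinge-(a) theorem K2 (`extremalHeadEMF_of_levelLip`, windows `Ioo t₀ 0`) on an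
arbitrary open time interval `Ioo α β`, by time translation.  Statement = the sketch's `NullTime.ExtremalHeadEMFOfLevelLipIoo` verbatim.  No NS
statement is involved. [folklore] -/
theorem extremalHeadEMF_of_levelLip_Ioo :
    ∀ (v : ℝ → E3 → E3) (x₀ : E3) (T P : ℝ → E3 → ℝ) (V : ℝ → ℝ) (α β : ℝ),
    ContDiffOn ℝ (⊤ : ℕ∞) (uncurry v) (Ioo α β ×ˢ univ) →
    ContDiffOn ℝ (⊤ : ℕ∞) (uncurry T) (Ioo α β ×ˢ ({x₀}ᶜ : Set E3)) →
    (∀ t ∈ Ioo α β, ContDiffOn ℝ 1 (P t) ({x₀}ᶜ : Set E3)) →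
    (∀ t ∈ Ioo α β, ∀ x, ‖v t x‖ ≤ V t) →
    (∀ t ∈ Ioo α β, ∀ x, x ≠ x₀ →
        cross (gradient (P t) x - (inner ℝ (v t x) (x - x₀)) • gradient (T t) x) (x - x₀) = 0) →
    (∀ t ∈ Ioo α β, ∀ r > 0, ∀ x ∈ Metric.sphere x₀ r, ∀ y ∈ Metric.sphere x₀ r,
        |P t x - P t y| ≤ (r * V t) * |T t x - T t y|) →
    ∃ I : ℝ → ℝ → ℝ,
      (∀ t ∈ Ioo α β, ∀ r > 0, ∀ xp ∈ sphArgmax (T t) x₀ r, ∀ xm ∈ sphArgmin (T t) x₀ r,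
          I t r = P t xp - P t xm) ∧
      ContinuousOn (uncurry I) (Ioo α β ×ˢ Ioi 0) ∧
      (∀ t ∈ Ioo α β, ∀ a b : ℝ, 0 < a → a < b → ∃ L : NNReal, LipschitzOnWith L (I t) (Icc a b)) ∧
      (∀ t ∈ Ioo α β, ∀ r > 0, |I t r| ≤ V t * netFlux (T t) x₀ r) ∧
      (∀ t ∈ Ioo α β, ∀ᵐ r : ℝ, 0 < r →
          deriv (I t) r ≤ sSup (radDeriv (P t) x₀ '' sphArgmax (T t) x₀ r)
                          - sInf (radDeriv (P t) x₀ '' sphArgmin (T t) x₀ r)) := by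
  intro v x₀ T P V α β hv hT hP hV hcross hfix
  -- membership transfer
  have hmem : ∀ {t : ℝ}, t ∈ Ioo α β → t - β ∈ Ioo (α - β) 0 := fun ht =>
    ⟨by linarith [ht.1], by linarith [ht.2]⟩
  have hmem' : ∀ {s : ℝ}, s ∈ Ioo (α - β) 0 → s + β ∈ Ioo α β := fun hs =>
    ⟨by linarith [hs.1], by linarith [hs.2]⟩
  -- K2 on the translated data
  obtain ⟨I', h1, h2, h3, h4, h5⟩ :=
    extremalHeadEMF_of_levelLip (fun s => v (s + β)) x₀ (fun s => T (s + β)) (fun s => P (s + β)) (fun s => V (s + β)) (α - β)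
      (contDiffOn_uncurry_timeShift hv) (contDiffOn_uncurry_timeShift hT) (fun s hs => hP _ (hmem' hs))
      (fun s hs => hV _ (hmem' hs)) (fun s hs => hcross _ (hmem' hs)) (fun s hs => hfix _ (hmem' hs))
  refine ⟨fun t r => I' (t - β) r, ?_, ?_, ?_, ?_, ?_⟩
  · -- (i)
    intro t ht r hr xp hxp xm hxm
    have := h1 (t - β) (hmem ht) r hr xp (by simpa only [sub_add_cancel] using hxp) xm (by simpa only [sub_add_cancel] using hxm)
    simpa only [sub_add_cancel] using this
  · -- (ii)
    have hmap : MapsTo (fun p : ℝ × ℝ => (p.1 - β, p.2)) (Ioo α β ×ˢ Ioi 0) (Ioo (α - β) 0 ×ˢ Ioi 0) := by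
      rintro ⟨t, r⟩ ⟨ht, hr⟩
      exact ⟨hmem ht, hr⟩
    have hφ : Continuous (fun p : ℝ × ℝ => (p.1 - β, p.2)) := (continuous_fst.sub continuous_const).prodMk continuous_snd
    exact h2.comp hφ.continuousOn hmap
  · -- (iii)
    intro t ht a b ha hab
    exact h3 (t - β) (hmem ht) a b ha hab
  · -- (iv)
    intro t ht r hr
    have := h4 (t - β) (hmem ht) r hr
    simpa only [sub_add_cancel] using this
  · -- (v)
    intro t ht
    have := h5 (t - β) (hmem ht)
    simpa only [sub_add_cancel] using this

end Summit.NavierStokesRegularity.NavierStokesRegularity.Theorems.PoloidalLiouville.NetFlux.NF1a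

end
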